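import Summits.ResolutionOfSingularities.ResolutionOfSingularities.Theorems.WeightedInvariantHypersurfaceCentreAlgebraize
import Literature.AlgebraicGeometry.Resolution.CotangentIndependenceSpread
import HarnessLib

/-!
# The cylinder presentation is OPEN along the stratum — (P3a-4) of ORDER (o28)
# (door `HypersurfaceCentreConstruction`, stmt-ResolutionOfSingularities-19897; KEY `stub_localWeightedDropEFT4S`, regime P3a
# «the top stratum is a regular germ of codimension two»; res-type-005, res-L1-w43-plan-1 ORDER (o28) 2026-08-27T09:31:23Z)

Topic: `Summits/ResolutionOfSingularities/ResolutionOfSingularities/Theorems`. Helper for the door item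
`HypersurfaceCentreConstruction` (stmt-ResolutionOfSingularities-19897, route `WeightedInvariant`).

FINDING 1 of the P3a probe memo (`plan/tools/res-type-005/o28/P3A-PROBE.md`): the cylinder value
`(jContact (R_𝔭) f m) ∩ R = (x, g; 1, b_max)_m` ((P3a-1), res-D-brk-1) wants the contact parameter `g` — and its partner
`x` — to be REGULAR PARAMETERS OF `R` generating the stratum prime, not merely of the two-dimensional object `R_𝔭`; at a
single local ring this can fail (`R = k[x,y,t]_(x,y,t)`, `𝔭 = (x, y)`, `g = t·x`).  MAIN THEOREM
(`ContactCylinder.exists_open_rsp_pair_along_prime`): on a MODEL it holds GENERICALLY ALONG THE STRATUM — for `R` of finite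
type over a perfect field, `𝔭` a prime with `R_𝔭` regular of Krull dimension two, and ANY `x, g ∈ R` whose images form a
regular system of parameters of `R_𝔭` (`(x, g) R_𝔭 = 𝔪_{R_𝔭}`), there is `h ∉ 𝔭` such that at every prime `𝔮 ∌ h`
containing `x` and `g`: `𝔭 ≤ 𝔮`, `R_𝔮` is regular, `(x, g) R_𝔮 = 𝔭 R_𝔮`, and `x, g` have linearly independent classes in
the cotangent space of `R_𝔮` (so `U = (x, g)`, `W = (1, b_max)` presents the cylinder rule on `D(h)`, the (pres) shape of
`CanonicalGameClause` with the cylinder directions omitted).  Bricks: independence of differentials spreads from a point to a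
neighbourhood (Literature `exists_notMem_forall_linearIndependent_toCotangent`, H2b A2), a minimal generating system of
`𝔪_{R_𝔭}` has independent differentials (stub-9, `linearIndependent_toCotangent_of_span_eq_of_spanFinrank_eq`), and clearing
the denominators of finitely many generators of `𝔭` (`exists_not_mem_and_mul_mem_of_map_mem`).
[OURS · L1 W4.3 · (o28) P3a-4]  Replaces the role of NO printed item; NOT a statement of the manuscript
[claim: Hironaka2017, status: under-review]. AI work, weaker than expert review.

## References

* H. Matsumura, Commutative Ring Theory (1987), Thm. 14.2 and §30, Cor. to Thm. 30.5. [Matsumura1987]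
* J. Włodarczyk, Functorial resolution except for toroidal locus. Toroidal compactification (2022), 2.1.10. [Wlodarczyk2022]
-/

noncomputable section

open IsLocalRing Literature.AlgebraicGeometry.Resolution

set_option linter.dupNamespace false -- mandated namespace of this single-conjunct summit

namespace Summit.ResolutionOfSingularities.ResolutionOfSingularities.Theorems

namespace ContactCylinder

/-- **Clearing a denominator**: if `p/1 ∈ I·R_𝔭` then `t p ∈ I` for some `t ∉ 𝔭`. [folklore] -/
theorem exists_not_mem_and_mul_mem_of_map_mem {R : Type} [CommRing R] (𝔭 : Ideal R) [𝔭.IsPrime] {I : Ideal R} {p : R}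
    (hp : algebraMap R (Localization.AtPrime 𝔭) p ∈ I.map (algebraMap R (Localization.AtPrime 𝔭))) :
    ∃ t ∉ 𝔭, t * p ∈ I := by
  obtain ⟨⟨⟨i, hi⟩, ⟨u, hu⟩⟩, h⟩ := (IsLocalization.mem_map_algebraMap_iff 𝔭.primeCompl _).mp hp
  simp only at h
  rw [← map_mul] at h
  obtain ⟨⟨c, hc⟩, hc'⟩ := (IsLocalization.eq_iff_exists 𝔭.primeCompl _).mp h
  simp only at hc'
  refine ⟨c * u, fun hmem => ?_, ?_⟩
  · rcases ‹𝔭.IsPrime›.mem_or_mem hmem with h1 | h1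
    exacts [hc h1, hu h1]
  · have : c * u * p = c * i := by rw [mul_assoc, mul_comm u p, hc']
    rw [this]
    exact I.mul_mem_left c hi

/-- **(P3a-4) — a regular system of parameters of the P2 object `R_𝔭` chosen in `𝔭` is, generically along `V(𝔭)`, a pair
of regular parameters generating the stratum prime.**  `R` of finite type over a perfect field `k`, `𝔭` prime with `R_𝔭`
regular of Krull dimension `2`, `x, g ∈ R` with `(x, g) R_𝔭 = 𝔪_{R_𝔭}`.  Then for some `h ∉ 𝔭` and every prime `𝔮 ∌ h`
with `x, g ∈ 𝔮`: `𝔭 ≤ 𝔮`; `R_𝔮` is a regular local ring; `(x, g) R_𝔮 = 𝔭 R_𝔮`; and the classes of `x, g` in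
`𝔪_{R_𝔮}/𝔪_{R_𝔮}²` are linearly independent. [OURS · L1 W4.3 · (o28) P3a-4]
[cite: Matsumura1987, Thm. 14.2; Wlodarczyk2022, 2.1.10] -/
theorem exists_open_rsp_pair_along_prime (k : Type) [Field k] [PerfectField k] (R : Type) [CommRing R] [Algebra k R]
    [Algebra.FiniteType k R] (𝔭 : Ideal R) [𝔭.IsPrime] [IsRegularLocalRing (Localization.AtPrime 𝔭)]
    (hdim : ringKrullDim (Localization.AtPrime 𝔭) = 2) (x g : R)
    (hxg : (Ideal.span {x, g}).map (algebraMap R (Localization.AtPrime 𝔭)) = maximalIdeal (Localization.AtPrime 𝔭)) :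
    ∃ h ∉ 𝔭, ∀ (𝔮 : Ideal R) [𝔮.IsPrime], h ∉ 𝔮 → x ∈ 𝔮 → g ∈ 𝔮 →
      𝔭 ≤ 𝔮 ∧ IsRegularLocalRing (Localization.AtPrime 𝔮) ∧
      (Ideal.span {x, g}).map (algebraMap R (Localization.AtPrime 𝔮)) = 𝔭.map (algebraMap R (Localization.AtPrime 𝔮)) ∧
      ∃ h𝔮 : ∀ i, algebraMap R (Localization.AtPrime 𝔮) ((![x, g] : Fin 2 → R) i) ∈ maximalIdeal (Localization.AtPrime 𝔮),
        LinearIndependent (ResidueField (Localization.AtPrime 𝔮)) fun i =>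
          (maximalIdeal (Localization.AtPrime 𝔮)).toCotangent ⟨algebraMap R _ ((![x, g] : Fin 2 → R) i), h𝔮 i⟩ := by
  classical
  haveI : IsNoetherianRing R := Algebra.FiniteType.isNoetherianRing k R
  have hrange : Set.range (![x, g] : Fin 2 → R) = {x, g} := by
    rw [Matrix.range_cons, Matrix.range_cons, Matrix.range_empty, Set.union_empty, Set.singleton_union]
  -- the images of `x, g` lie in `𝔪_{R_𝔭}`; `x, g ∈ 𝔭`
  have hmemA : ∀ i, algebraMap R (Localization.AtPrime 𝔭) ((![x, g] : Fin 2 → R) i) ∈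
      maximalIdeal (Localization.AtPrime 𝔭) := by
    intro i
    rw [← hxg]
    exact Ideal.mem_map_of_mem _ (Ideal.subset_span (by rw [← hrange]; exact ⟨i, rfl⟩))
  have hx𝔭 : x ∈ 𝔭 := (IsLocalization.AtPrime.to_map_mem_maximal_iff (Localization.AtPrime 𝔭) 𝔭 x).mp (hmemA 0)
  have hg𝔭 : g ∈ 𝔭 := (IsLocalization.AtPrime.to_map_mem_maximal_iff (Localization.AtPrime 𝔭) 𝔭 g).mp (hmemA 1)
  have hxg𝔭 : Ideal.span {x, g} ≤ 𝔭 := by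
    rw [Ideal.span_le]
    rintro z (rfl | rfl)
    exacts [hx𝔭, hg𝔭]
  -- independence at `𝔭`: a minimal generating system of `𝔪_{R_𝔭}`
  have hspan : Ideal.span (Set.range fun i => algebraMap R (Localization.AtPrime 𝔭) ((![x, g] : Fin 2 → R) i)) =
      maximalIdeal (Localization.AtPrime 𝔭) := by
    rw [← hxg, Ideal.map_span, ← hrange, ← Set.range_comp]
    rfl
  have hsf : (maximalIdeal (Localization.AtPrime 𝔭)).spanFinrank = 2 := by
    have h2 := IsRegularLocalRing.spanFinrank_maximalIdeal (R := Localization.AtPrime 𝔭)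
    rw [hdim] at h2
    exact_mod_cast h2
  have hli := linearIndependent_toCotangent_of_span_eq_of_spanFinrank_eq _ hspan hsf
  -- independence and regularity spread to a neighbourhood
  obtain ⟨f₁, hf₁, H₁⟩ := exists_notMem_forall_linearIndependent_toCotangent k 𝔭 ![x, g] hmemA hli
  -- generators of `𝔭` and their denominators
  obtain ⟨s, hs⟩ := (IsNoetherian.noetherian 𝔭 : 𝔭.FG)
  have hs𝔭 : ∀ p ∈ s, p ∈ 𝔭 := fun p hp => hs ▸ Ideal.subset_span hp
  have hden : ∀ p : R, p ∈ 𝔭 → ∃ t ∉ 𝔭, t * p ∈ Ideal.span {x, g} := fun p hp =>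
    exists_not_mem_and_mul_mem_of_map_mem 𝔭 (by
      rw [hxg]
      exact (IsLocalization.AtPrime.to_map_mem_maximal_iff (Localization.AtPrime 𝔭) 𝔭 p).mpr hp)
  choose t ht htp using hden
  let T : s → R := fun p => t p.1 (hs𝔭 p.1 p.2)
  let h : R := f₁ * ∏ p ∈ s.attach, T p
  have hT𝔭 : ∀ p : s, T p ∉ 𝔭 := fun p => ht p.1 (hs𝔭 p.1 p.2)
  have hh : h ∉ 𝔭 := by
    have hprod : (∏ p ∈ s.attach, T p) ∈ 𝔭.primeCompl := prod_mem fun p _ => (hT𝔭 p : T p ∈ 𝔭.primeCompl)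
    exact (Submonoid.mul_mem _ (hf₁ : f₁ ∈ 𝔭.primeCompl) hprod : h ∈ 𝔭.primeCompl)
  refine ⟨h, hh, fun 𝔮 _ hh𝔮 hx𝔮 hg𝔮 => ?_⟩
  -- `f₁ ∉ 𝔮` and every denominator is a unit at `𝔮`
  have hf₁𝔮 : f₁ ∉ 𝔮 := fun hmem => hh𝔮 (Ideal.mul_mem_right _ _ hmem)
  have hT𝔮 : ∀ p : s, T p ∉ 𝔮 := by
    intro p hmem
    apply hh𝔮
    obtain ⟨c, hc⟩ := Finset.dvd_prod_of_mem T (Finset.mem_attach s p)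
    change f₁ * ∏ p ∈ s.attach, T p ∈ 𝔮
    rw [hc, ← mul_assoc]
    exact Ideal.mul_mem_right _ _ (Ideal.mul_mem_left _ _ hmem)
  have hxg𝔮 : Ideal.span {x, g} ≤ 𝔮 := by
    rw [Ideal.span_le]
    rintro z (rfl | rfl)
    exacts [hx𝔮, hg𝔮]
  -- `𝔭 ≤ 𝔮`
  have h𝔭𝔮 : 𝔭 ≤ 𝔮 := by
    rw [← hs, Ideal.span_le]
    intro p hp
    have hmem : T ⟨p, hp⟩ * p ∈ 𝔮 := hxg𝔮 (htp p (hs𝔭 p hp))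
    exact (‹𝔮.IsPrime›.mem_or_mem hmem).resolve_left (hT𝔮 ⟨p, hp⟩)
  obtain ⟨hreg, h𝔮, hli𝔮⟩ := H₁ 𝔮 hf₁𝔮 (fun i => by fin_cases i <;> assumption)
  refine ⟨h𝔭𝔮, hreg, ?_, h𝔮, hli𝔮⟩
  -- `(x, g) R_𝔮 = 𝔭 R_𝔮`
  apply le_antisymm (Ideal.map_mono hxg𝔭)
  conv_lhs => rw [← hs]
  rw [Ideal.map_span, Ideal.span_le]
  rintro _ ⟨p, hp, rfl⟩
  have hunit : IsUnit (algebraMap R (Localization.AtPrime 𝔮) (T ⟨p, hp⟩)) :=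
    IsLocalization.map_units (M := 𝔮.primeCompl) (Localization.AtPrime 𝔮) ⟨T ⟨p, hp⟩, hT𝔮 ⟨p, hp⟩⟩
  have hmem : algebraMap R (Localization.AtPrime 𝔮) (T ⟨p, hp⟩) * algebraMap R (Localization.AtPrime 𝔮) p ∈
      (Ideal.span {x, g}).map (algebraMap R (Localization.AtPrime 𝔮)) := by
    rw [← map_mul]
    exact Ideal.mem_map_of_mem _ (htp p (hs𝔭 p hp))
  exact (Ideal.unit_mul_mem_iff_mem _ hunit).mp hmem

end ContactCylinder

end Summit.ResolutionOfSingularities.ResolutionOfSingularities.Theorems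

end
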